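import Mathlib
import HarnessLib

/-!
# Route `SullivanDual`, crux `HyperbolicEnd` (stmt-SmoothPoincare4-7825), line `taubes-circle-pencil`:
# planar calculus for the isoperimetric argument (registered helper `helper_hasDerivAt_circulation`)

Flat, Mathlib-only one- and two-variable calculus feeding the registered stub
`stub_noWitnessOffDefect` (S2: no non-constant entire `J`-curve in a compact set on which `J` is
tamed by an EXACT form `dλ`; file `SullivanDualHyperbolicEndStubNoWitnessOffDefect.lean`, where the
planar isoperimetric lemma `helper_curl_eq_zero_of_sq_le_mul_curl` is assembled from the two
results below and Cauchy–Schwarz).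

* **Stokes on discs, differentiated** (`hasDerivAt_circulation`, registered as
  `helper_hasDerivAt_circulation`).  For a `1`-form `β = b₁ dx + b₂ dy` on `ℂ` with `C¹`
  coefficients, the CIRCULATION along the circle of radius `R`,
  `Φ(R) = ∮_{∂D_R} β = ∫_{-π}^{π} R (cos θ · b₂ - sin θ · b₁)(R e^{iθ}) dθ`, is differentiable in
  `R` with `Φ'(R) = R ∫_{-π}^{π} (∂ₓ b₂ - ∂_y b₁)(R e^{iθ}) dθ` (`= ∮_{∂D_R} dβ(∂_R, ·)`, i.e.
  `d/dR ∫_{D_R} dβ`).  Proof: differentiate under the integral sign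
  (`intervalIntegral.hasDerivAt_integral_of_dominated_loc_of_deriv_le`; the derivative is jointly
  continuous hence locally uniformly bounded), use the pointwise identity
  `∂_R(β(∂_θ)) - ∂_θ(β(∂_R)) = dβ(∂_R, ∂_θ) = R · (∂ₓ b₂ - ∂_y b₁)` (`circulation_pointwise`) and
  the periodicity of `θ ↦ β(∂_R)` (`integral_radialComponent_deriv`).
* **The ODE lemma** (`eq_zero_of_sq_le_mul_deriv`): `Φ(0) = 0`, `Φ' ≥ 0` on `[0, ∞)` and
  `Φ² ≤ C R Φ'` for `R > 0` force `Φ = 0` on `[0, ∞)` (else `1/Φ + C⁻¹ log R` is non-increasing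
  on `[R₀, ∞)` while staying positive).
(Cauchy–Schwarz on an interval, the third elementary input of the isoperimetric argument, is the
tree's `Literature.Analysis.ODE.sq_intervalIntegral_le`.)  No definitions, no named facts.
-/

-- the registered namespace `Summit.SmoothPoincare4.SmoothPoincare4.…` repeats a component (P = Sub)
set_option linter.dupNamespace false

noncomputable section

open scoped Topology Real
open Set Filter MeasureTheory intervalIntegral

namespace Summit.SmoothPoincare4.SmoothPoincare4.Cruxes.HyperbolicEnd.TaubesCirclePencil

/-! ### Derivatives along radius and angle of functions composed with `circleMap 0 R θ` -/

/-- `d/dR circleMap 0 R θ = circleMap 0 1 θ = e^{iθ}`. [folklore] -/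
theorem hasDerivAt_circleMap_radius (R θ : ℝ) :
    HasDerivAt (fun R : ℝ => circleMap 0 R θ) (circleMap 0 1 θ) R := by
  have h := ((hasDerivAt_id R).ofReal_comp).mul_const (Complex.exp (θ * Complex.I))
  simp only [circleMap, zero_add, id] at h ⊢
  convert h using 1

/-- A real-linear functional on `ℂ` decomposes as `L w = re w · L 1 + im w · L i`. [folklore] -/
theorem clm_apply_eq_re_im (L : ℂ →L[ℝ] ℝ) (w : ℂ) :
    L w = w.re * L 1 + w.im * L Complex.I := by
  have hw : w = (w.re : ℝ) • (1 : ℂ) + (w.im : ℝ) • Complex.I := by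
    rw [Complex.real_smul, Complex.real_smul, mul_one]
    exact (Complex.re_add_im w).symm
  conv_lhs => rw [hw]
  rw [map_add, map_smul, map_smul, smul_eq_mul, smul_eq_mul]

/-- Real and imaginary parts of `e^{iθ}` and of `i R e^{iθ}`. [folklore] -/
theorem circleMap_re_im (R θ : ℝ) :
    (circleMap 0 1 θ).re = Real.cos θ ∧ (circleMap 0 1 θ).im = Real.sin θ ∧
      (circleMap 0 R θ * Complex.I).re = -(R * Real.sin θ) ∧
      (circleMap 0 R θ * Complex.I).im = R * Real.cos θ := by
  refine ⟨?_, ?_, ?_, ?_⟩ <;>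
    simp [circleMap, Complex.exp_ofReal_mul_I_re, Complex.exp_ofReal_mul_I_im, Complex.mul_re,
      Complex.mul_im]

/-! ### The circulation integrand and its radial derivative -/

variable {b₁ b₂ : ℂ → ℝ}

/-- Radial derivative of `b ∘ circleMap`. [folklore] -/
theorem hasDerivAt_comp_circleMap_radius {b : ℂ → ℝ} (hb : ContDiff ℝ 1 b) (R θ : ℝ) :
    HasDerivAt (fun R : ℝ => b (circleMap 0 R θ))
      (fderiv ℝ b (circleMap 0 R θ) (circleMap 0 1 θ)) R :=
  ((hb.differentiable one_ne_zero) _).hasFDerivAt.comp_hasDerivAt R (hasDerivAt_circleMap_radius R θ)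

/-- Angular derivative of `b ∘ circleMap`. [folklore] -/
theorem hasDerivAt_comp_circleMap_angle {b : ℂ → ℝ} (hb : ContDiff ℝ 1 b) (R θ : ℝ) :
    HasDerivAt (fun θ : ℝ => b (circleMap 0 R θ))
      (fderiv ℝ b (circleMap 0 R θ) (circleMap 0 R θ * Complex.I)) θ :=
  ((hb.differentiable one_ne_zero) _).hasFDerivAt.comp_hasDerivAt θ (hasDerivAt_circleMap 0 R θ)

/-- **Radial derivative of the circulation integrand** `g(R, θ) = R (cos θ · b₂ - sin θ · b₁)(R e^{iθ})`
of the `1`-form `b₁ dx + b₂ dy` along the circle of radius `R`. [folklore] -/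
theorem hasDerivAt_circulationIntegrand (hb₁ : ContDiff ℝ 1 b₁) (hb₂ : ContDiff ℝ 1 b₂) (R θ : ℝ) :
    HasDerivAt (fun R : ℝ => R * (Real.cos θ * b₂ (circleMap 0 R θ) - Real.sin θ * b₁ (circleMap 0 R θ)))
      ((Real.cos θ * b₂ (circleMap 0 R θ) - Real.sin θ * b₁ (circleMap 0 R θ)) +
        R * (Real.cos θ * fderiv ℝ b₂ (circleMap 0 R θ) (circleMap 0 1 θ) -
          Real.sin θ * fderiv ℝ b₁ (circleMap 0 R θ) (circleMap 0 1 θ))) R := by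
  have h := ((hasDerivAt_comp_circleMap_radius hb₂ R θ).const_mul (Real.cos θ)).fun_sub
    ((hasDerivAt_comp_circleMap_radius hb₁ R θ).const_mul (Real.sin θ))
  have h2 := (hasDerivAt_id' R).fun_mul h
  simpa using h2

/-- **Angular derivative of the radial component** `h(R, θ) = (cos θ · b₁ + sin θ · b₂)(R e^{iθ})`.
[folklore] -/
theorem hasDerivAt_radialComponent (hb₁ : ContDiff ℝ 1 b₁) (hb₂ : ContDiff ℝ 1 b₂) (R θ : ℝ) :
    HasDerivAt (fun θ : ℝ => Real.cos θ * b₁ (circleMap 0 R θ) + Real.sin θ * b₂ (circleMap 0 R θ))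
      ((-Real.sin θ * b₁ (circleMap 0 R θ) +
          Real.cos θ * fderiv ℝ b₁ (circleMap 0 R θ) (circleMap 0 R θ * Complex.I)) +
        (Real.cos θ * b₂ (circleMap 0 R θ) +
          Real.sin θ * fderiv ℝ b₂ (circleMap 0 R θ) (circleMap 0 R θ * Complex.I))) θ := by
  have h1 := (Real.hasDerivAt_cos θ).fun_mul (hasDerivAt_comp_circleMap_angle hb₁ R θ)
  have h2 := (Real.hasDerivAt_sin θ).fun_mul (hasDerivAt_comp_circleMap_angle hb₂ R θ)
  exact h1.fun_add h2

/-- **The pointwise Stokes identity**: `∂_R g - ∂_θ h = R · (∂ₓ b₂ - ∂_y b₁)(R e^{iθ})`.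
[folklore] -/
theorem circulation_pointwise (R θ : ℝ) :
    ((Real.cos θ * b₂ (circleMap 0 R θ) - Real.sin θ * b₁ (circleMap 0 R θ)) +
        R * (Real.cos θ * fderiv ℝ b₂ (circleMap 0 R θ) (circleMap 0 1 θ) -
          Real.sin θ * fderiv ℝ b₁ (circleMap 0 R θ) (circleMap 0 1 θ))) -
      ((-Real.sin θ * b₁ (circleMap 0 R θ) +
          Real.cos θ * fderiv ℝ b₁ (circleMap 0 R θ) (circleMap 0 R θ * Complex.I)) +
        (Real.cos θ * b₂ (circleMap 0 R θ) +
          Real.sin θ * fderiv ℝ b₂ (circleMap 0 R θ) (circleMap 0 R θ * Complex.I))) =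
      R * (fderiv ℝ b₂ (circleMap 0 R θ) 1 - fderiv ℝ b₁ (circleMap 0 R θ) Complex.I) := by
  obtain ⟨h1, h2, h3, h4⟩ := circleMap_re_im R θ
  rw [clm_apply_eq_re_im (fderiv ℝ b₂ (circleMap 0 R θ)) (circleMap 0 1 θ),
    clm_apply_eq_re_im (fderiv ℝ b₁ (circleMap 0 R θ)) (circleMap 0 1 θ),
    clm_apply_eq_re_im (fderiv ℝ b₁ (circleMap 0 R θ)) (circleMap 0 R θ * Complex.I),
    clm_apply_eq_re_im (fderiv ℝ b₂ (circleMap 0 R θ)) (circleMap 0 R θ * Complex.I),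
    h1, h2, h3, h4]
  have hcs := Real.cos_sq_add_sin_sq θ
  linear_combination (R * (fderiv ℝ b₂ (circleMap 0 R θ) 1 - fderiv ℝ b₁ (circleMap 0 R θ) Complex.I)) * hcs

/-- **The angular derivative integrates to zero over a full turn** (periodicity). [folklore] -/
theorem integral_radialComponent_deriv (hb₁ : ContDiff ℝ 1 b₁) (hb₂ : ContDiff ℝ 1 b₂) (R : ℝ) :
    ∫ θ in (-π)..π, ((-Real.sin θ * b₁ (circleMap 0 R θ) +
          Real.cos θ * fderiv ℝ b₁ (circleMap 0 R θ) (circleMap 0 R θ * Complex.I)) +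
        (Real.cos θ * b₂ (circleMap 0 R θ) +
          Real.sin θ * fderiv ℝ b₂ (circleMap 0 R θ) (circleMap 0 R θ * Complex.I))) = 0 := by
  have hcont : Continuous fun θ : ℝ => ((-Real.sin θ * b₁ (circleMap 0 R θ) +
          Real.cos θ * fderiv ℝ b₁ (circleMap 0 R θ) (circleMap 0 R θ * Complex.I)) +
        (Real.cos θ * b₂ (circleMap 0 R θ) +
          Real.sin θ * fderiv ℝ b₂ (circleMap 0 R θ) (circleMap 0 R θ * Complex.I))) := by
    have hc : Continuous fun θ : ℝ => circleMap 0 R θ := continuous_circleMap 0 R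
    have hd1 : Continuous (fderiv ℝ b₁) := hb₁.continuous_fderiv one_ne_zero
    have hd2 : Continuous (fderiv ℝ b₂) := hb₂.continuous_fderiv one_ne_zero
    fun_prop
  rw [intervalIntegral.integral_eq_sub_of_hasDerivAt (fun θ _ => hasDerivAt_radialComponent hb₁ hb₂ R θ)
    (hcont.intervalIntegrable _ _)]
  have hper : circleMap 0 R π = circleMap 0 R (-π) := by
    have := periodic_circleMap 0 R (-π)
    rw [show -π + 2 * π = π by ring] at this
    exact this
  simp [hper, Real.cos_neg, Real.sin_neg]

/-! ### Differentiation of the circulation under the integral sign -/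

/-- `(R, θ) ↦ circleMap 0 R θ` is continuous. [folklore] -/
theorem continuous_circleMap_uncurry : Continuous fun p : ℝ × ℝ => circleMap 0 p.1 p.2 := by
  unfold circleMap
  fun_prop

/-- Joint continuity of the radial derivative of the circulation integrand. [folklore] -/
theorem continuous_circulationIntegrand_deriv (hb₁ : ContDiff ℝ 1 b₁) (hb₂ : ContDiff ℝ 1 b₂) :
    Continuous fun p : ℝ × ℝ =>
      (Real.cos p.2 * b₂ (circleMap 0 p.1 p.2) - Real.sin p.2 * b₁ (circleMap 0 p.1 p.2)) +
        p.1 * (Real.cos p.2 * fderiv ℝ b₂ (circleMap 0 p.1 p.2) (circleMap 0 1 p.2) -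
          Real.sin p.2 * fderiv ℝ b₁ (circleMap 0 p.1 p.2) (circleMap 0 1 p.2)) := by
  have hc := continuous_circleMap_uncurry
  have hc1 : Continuous fun p : ℝ × ℝ => circleMap 0 1 p.2 := (continuous_circleMap 0 1).comp continuous_snd
  have hd1 : Continuous (fderiv ℝ b₁) := hb₁.continuous_fderiv one_ne_zero
  have hd2 : Continuous (fderiv ℝ b₂) := hb₂.continuous_fderiv one_ne_zero
  have hb₁c : Continuous b₁ := hb₁.continuous
  have hb₂c : Continuous b₂ := hb₂.continuous
  have e1 : Continuous fun p : ℝ × ℝ => fderiv ℝ b₁ (circleMap 0 p.1 p.2) (circleMap 0 1 p.2) :=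
    (hd1.comp hc).clm_apply hc1
  have e2 : Continuous fun p : ℝ × ℝ => fderiv ℝ b₂ (circleMap 0 p.1 p.2) (circleMap 0 1 p.2) :=
    (hd2.comp hc).clm_apply hc1
  fun_prop

/-- Continuity in `θ` of the circulation integrand at fixed radius. [folklore] -/
theorem continuous_circulationIntegrand (hb₁ : ContDiff ℝ 1 b₁) (hb₂ : ContDiff ℝ 1 b₂) (R : ℝ) :
    Continuous fun θ : ℝ =>
      R * (Real.cos θ * b₂ (circleMap 0 R θ) - Real.sin θ * b₁ (circleMap 0 R θ)) := by
  have hc : Continuous fun θ : ℝ => circleMap 0 R θ := continuous_circleMap 0 R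
  have hb₁c : Continuous b₁ := hb₁.continuous
  have hb₂c : Continuous b₂ := hb₂.continuous
  fun_prop

/-- **Differentiation of the circulation under the integral sign.** [folklore] -/
theorem hasDerivAt_circulation_aux (hb₁ : ContDiff ℝ 1 b₁) (hb₂ : ContDiff ℝ 1 b₂) (R₀ : ℝ) :
    HasDerivAt (fun R : ℝ => ∫ θ in (-π)..π,
        R * (Real.cos θ * b₂ (circleMap 0 R θ) - Real.sin θ * b₁ (circleMap 0 R θ)))
      (∫ θ in (-π)..π,
        ((Real.cos θ * b₂ (circleMap 0 R₀ θ) - Real.sin θ * b₁ (circleMap 0 R₀ θ)) +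
          R₀ * (Real.cos θ * fderiv ℝ b₂ (circleMap 0 R₀ θ) (circleMap 0 1 θ) -
            Real.sin θ * fderiv ℝ b₁ (circleMap 0 R₀ θ) (circleMap 0 1 θ)))) R₀ := by
  set G : ℝ → ℝ → ℝ := fun R θ =>
    R * (Real.cos θ * b₂ (circleMap 0 R θ) - Real.sin θ * b₁ (circleMap 0 R θ)) with hG
  set G' : ℝ → ℝ → ℝ := fun R θ =>
    (Real.cos θ * b₂ (circleMap 0 R θ) - Real.sin θ * b₁ (circleMap 0 R θ)) +
      R * (Real.cos θ * fderiv ℝ b₂ (circleMap 0 R θ) (circleMap 0 1 θ) -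
        Real.sin θ * fderiv ℝ b₁ (circleMap 0 R θ) (circleMap 0 1 θ)) with hG'
  have hG'c : Continuous (Function.uncurry G') := continuous_circulationIntegrand_deriv hb₁ hb₂
  -- a uniform bound for `G'` on `[R₀ - 1, R₀ + 1] × [-π, π]`
  obtain ⟨B, hB⟩ := ((isCompact_Icc (a := R₀ - 1) (b := R₀ + 1)).prod
    (isCompact_Icc (a := -π) (b := π))).exists_bound_of_continuousOn hG'c.continuousOn
  have key := intervalIntegral.hasDerivAt_integral_of_dominated_loc_of_deriv_le
    (μ := volume) (a := -π) (b := π) (F := G) (F' := G') (x₀ := R₀) (bound := fun _ => B)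
    (s := Ioo (R₀ - 1) (R₀ + 1)) (Ioo_mem_nhds (by linarith) (by linarith))
    (Eventually.of_forall fun R =>
      (continuous_circulationIntegrand hb₁ hb₂ R).aestronglyMeasurable)
    ((continuous_circulationIntegrand hb₁ hb₂ R₀).intervalIntegrable _ _)
    ((hG'c.comp (Continuous.prodMk_right R₀)).aestronglyMeasurable)
    (ae_of_all _ fun θ hθ R hR => by
      have hθ' : θ ∈ Icc (-π) π := by
        rw [uIoc_of_le (by linarith [Real.pi_pos])] at hθ
        exact Ioc_subset_Icc_self hθ
      exact hB (R, θ) ⟨Ioo_subset_Icc_self hR, hθ'⟩)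
    intervalIntegrable_const
    (ae_of_all _ fun θ _ R _ => hasDerivAt_circulationIntegrand hb₁ hb₂ R θ)
  exact key.2

/-- **Stokes on the disc, differentiated**: the circulation `Φ(R) = ∮_{∂D_R} (b₁ dx + b₂ dy)`
satisfies `Φ'(R) = R ∫_{-π}^{π} (∂ₓ b₂ - ∂_y b₁)(R e^{iθ}) dθ`. [folklore] -/
theorem hasDerivAt_circulation (hb₁ : ContDiff ℝ 1 b₁) (hb₂ : ContDiff ℝ 1 b₂) (R : ℝ) :
    HasDerivAt (fun R : ℝ => ∫ θ in (-π)..π,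
        R * (Real.cos θ * b₂ (circleMap 0 R θ) - Real.sin θ * b₁ (circleMap 0 R θ)))
      (R * ∫ θ in (-π)..π,
        (fderiv ℝ b₂ (circleMap 0 R θ) 1 - fderiv ℝ b₁ (circleMap 0 R θ) Complex.I)) R := by
  have h := hasDerivAt_circulation_aux hb₁ hb₂ R
  convert h using 1
  -- the integrands differ by the angular derivative of the radial component, of zero integral
  have hd1 : Continuous (fderiv ℝ b₁) := hb₁.continuous_fderiv one_ne_zero
  have hd2 : Continuous (fderiv ℝ b₂) := hb₂.continuous_fderiv one_ne_zero
  have hb₁c : Continuous b₁ := hb₁.continuous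
  have hb₂c : Continuous b₂ := hb₂.continuous
  have hc : Continuous fun θ : ℝ => circleMap 0 R θ := continuous_circleMap 0 R
  have hFc : Continuous fun θ : ℝ =>
      R * (fderiv ℝ b₂ (circleMap 0 R θ) 1 - fderiv ℝ b₁ (circleMap 0 R θ) Complex.I) := by
    fun_prop
  have hHc : Continuous fun θ : ℝ => ((-Real.sin θ * b₁ (circleMap 0 R θ) +
          Real.cos θ * fderiv ℝ b₁ (circleMap 0 R θ) (circleMap 0 R θ * Complex.I)) +
        (Real.cos θ * b₂ (circleMap 0 R θ) +
          Real.sin θ * fderiv ℝ b₂ (circleMap 0 R θ) (circleMap 0 R θ * Complex.I))) := by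
    fun_prop
  have e : (fun θ : ℝ => (Real.cos θ * b₂ (circleMap 0 R θ) - Real.sin θ * b₁ (circleMap 0 R θ)) +
          R * (Real.cos θ * fderiv ℝ b₂ (circleMap 0 R θ) (circleMap 0 1 θ) -
            Real.sin θ * fderiv ℝ b₁ (circleMap 0 R θ) (circleMap 0 1 θ))) =
      fun θ : ℝ => ((-Real.sin θ * b₁ (circleMap 0 R θ) +
          Real.cos θ * fderiv ℝ b₁ (circleMap 0 R θ) (circleMap 0 R θ * Complex.I)) +
        (Real.cos θ * b₂ (circleMap 0 R θ) +
          Real.sin θ * fderiv ℝ b₂ (circleMap 0 R θ) (circleMap 0 R θ * Complex.I))) +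
        R * (fderiv ℝ b₂ (circleMap 0 R θ) 1 - fderiv ℝ b₁ (circleMap 0 R θ) Complex.I) := by
    funext θ
    have := circulation_pointwise (b₁ := b₁) (b₂ := b₂) R θ
    linarith
  rw [e, intervalIntegral.integral_add (hHc.intervalIntegrable _ _) (hFc.intervalIntegrable _ _),
    integral_radialComponent_deriv hb₁ hb₂ R, zero_add, intervalIntegral.integral_const_mul]


-- registered signature, verbatim on one line (gate matches name + header textually)
/-- **Stokes on discs, differentiated** (registered helper): for `C¹` functions `b₁, b₂ : ℂ → ℝ`
the circulation `R ↦ ∮_{∂D_R} (b₁ dx + b₂ dy) = ∫_{-π}^{π} R (cos θ b₂ - sin θ b₁)(R e^{iθ}) dθ` has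
derivative `R ∫_{-π}^{π} (∂ₓ b₂ - ∂_y b₁)(R e^{iθ}) dθ` at every `R` (`hasDerivAt_circulation`).
[folklore] -/
theorem helper_hasDerivAt_circulation : ∀ (b₁ b₂ : ℂ → ℝ) (R : ℝ), ContDiff ℝ 1 b₁ → ContDiff ℝ 1 b₂ → HasDerivAt (fun R : ℝ => ∫ θ in (-Real.pi)..Real.pi, R * (Real.cos θ * b₂ (circleMap 0 R θ) - Real.sin θ * b₁ (circleMap 0 R θ))) (R * ∫ θ in (-Real.pi)..Real.pi, (fderiv ℝ b₂ (circleMap 0 R θ) 1 - fderiv ℝ b₁ (circleMap 0 R θ) Complex.I)) R := by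
  intro b₁ b₂ R hb₁ hb₂
  exact hasDerivAt_circulation hb₁ hb₂ R

/-! ### The isoperimetric differential inequality `Φ² ≤ C R Φ'` forces `Φ = 0` -/

/-- **ODE lemma of the isoperimetric argument.**  If `Φ : ℝ → ℝ` is differentiable with
`Φ 0 = 0`, `Φ' ≥ 0` on `[0, ∞)` and `Φ(R)² ≤ C R Φ'(R)` for `R > 0` (`C > 0`), then `Φ = 0` on
`[0, ∞)`: otherwise `1/Φ + C⁻¹ log R` is non-increasing on `[R₀, ∞)` while `Φ > 0` there, which is
absurd for `R` large. [folklore] -/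
theorem eq_zero_of_sq_le_mul_deriv {Φ Φ' : ℝ → ℝ} {C : ℝ} (hC : 0 < C)
    (hd : ∀ R, HasDerivAt Φ (Φ' R) R) (h0 : Φ 0 = 0) (hpos : ∀ R, 0 ≤ R → 0 ≤ Φ' R)
    (hineq : ∀ R, 0 < R → Φ R ^ 2 ≤ C * R * Φ' R) : ∀ R, 0 ≤ R → Φ R = 0 := by
  have hc : Continuous Φ := continuous_iff_continuousAt.2 fun R => (hd R).continuousAt
  have hderiv : deriv Φ = Φ' := funext fun R => (hd R).deriv
  have hmono : MonotoneOn Φ (Ici 0) :=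
    monotoneOn_of_deriv_nonneg (convex_Ici 0) hc.continuousOn
      (fun R _ => (hd R).differentiableAt.differentiableWithinAt)
      (by
        intro R hR
        rw [interior_Ici] at hR
        rw [hderiv]
        exact hpos R (le_of_lt hR))
  by_contra hcon
  push Not at hcon
  obtain ⟨R₀, hR₀, hΦR₀⟩ := hcon
  have hnn : 0 ≤ Φ R₀ := by
    have := hmono (self_mem_Ici (a := (0 : ℝ))) (mem_Ici.2 hR₀) hR₀
    rwa [h0] at this
  have hΦpos : 0 < Φ R₀ := lt_of_le_of_ne hnn (Ne.symm hΦR₀)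
  have hR₀pos : 0 < R₀ := by
    rcases eq_or_lt_of_le hR₀ with h | h
    · exfalso; rw [← h, h0] at hΦpos; exact lt_irrefl _ hΦpos
    · exact h
  -- `Φ ≥ Φ R₀ > 0` on `[R₀, ∞)`
  have hge : ∀ R, R₀ ≤ R → Φ R₀ ≤ Φ R := fun R hR =>
    hmono (mem_Ici.2 hR₀) (mem_Ici.2 (hR₀.trans hR)) hR
  have hposR : ∀ R, R₀ ≤ R → 0 < Φ R := fun R hR => hΦpos.trans_le (hge R hR)
  -- the auxiliary function `ψ = 1/Φ + C⁻¹ log`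
  set ψ : ℝ → ℝ := fun R => (Φ R)⁻¹ + C⁻¹ * Real.log R with hψ
  have hψd : ∀ R, R₀ ≤ R →
      HasDerivAt ψ (-(Φ' R) / (Φ R) ^ 2 + C⁻¹ * R⁻¹) R := by
    intro R hR
    have h1 : HasDerivAt (fun R => (Φ R)⁻¹) (-(Φ' R) / (Φ R) ^ 2) R :=
      (hd R).inv (hposR R hR).ne'
    have h2 : HasDerivAt (fun R => C⁻¹ * Real.log R) (C⁻¹ * R⁻¹) R :=
      (Real.hasDerivAt_log (hR₀pos.trans_le hR).ne').const_mul C⁻¹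
    exact h1.add h2
  have hψle : ∀ R, R₀ ≤ R → -(Φ' R) / (Φ R) ^ 2 + C⁻¹ * R⁻¹ ≤ 0 := by
    intro R hR
    have hRp : 0 < R := hR₀pos.trans_le hR
    have hΦp : 0 < Φ R := hposR R hR
    have key := hineq R hRp
    have h3 : C⁻¹ * R⁻¹ ≤ Φ' R / Φ R ^ 2 := by
      rw [le_div_iff₀ (by positivity)]
      calc C⁻¹ * R⁻¹ * Φ R ^ 2 = Φ R ^ 2 / (C * R) := by
            field_simp
        _ ≤ Φ' R := by
            rw [div_le_iff₀ (by positivity)]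
            linarith [key]
    have h4 : -(Φ' R) / (Φ R) ^ 2 = -(Φ' R / Φ R ^ 2) := by ring
    rw [h4]
    linarith
  have hanti : AntitoneOn ψ (Ici R₀) := by
    refine antitoneOn_of_deriv_nonpos (convex_Ici R₀) ?_ ?_ ?_
    · exact fun R hR => (hψd R hR).continuousAt.continuousWithinAt
    · intro R hR
      rw [interior_Ici] at hR
      exact (hψd R (le_of_lt hR)).differentiableAt.differentiableWithinAt
    · intro R hR
      rw [interior_Ici] at hR
      rw [(hψd R (le_of_lt hR)).deriv]
      exact hψle R (le_of_lt hR)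
  -- evaluate at a large radius
  set R₁ : ℝ := R₀ * Real.exp (C * ((Φ R₀)⁻¹ + 1)) with hR₁
  have hexp : 1 ≤ Real.exp (C * ((Φ R₀)⁻¹ + 1)) := by
    apply Real.one_le_exp
    have : 0 < (Φ R₀)⁻¹ := inv_pos.2 hΦpos
    positivity
  have hR₀R₁ : R₀ ≤ R₁ := by
    rw [hR₁]
    nlinarith
  have hlog : Real.log R₁ = Real.log R₀ + C * ((Φ R₀)⁻¹ + 1) := by
    rw [hR₁, Real.log_mul hR₀pos.ne' (Real.exp_pos _).ne', Real.log_exp]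
  have hψR₁ : ψ R₁ ≤ ψ R₀ := hanti (mem_Ici.2 le_rfl) (mem_Ici.2 hR₀R₁) hR₀R₁
  have hψR₁' : (Φ R₁)⁻¹ ≤ -1 := by
    simp only [hψ, hlog] at hψR₁
    have e : C⁻¹ * (Real.log R₀ + C * ((Φ R₀)⁻¹ + 1)) =
        C⁻¹ * Real.log R₀ + ((Φ R₀)⁻¹ + 1) := by
      field_simp
    rw [e] at hψR₁
    linarith
  have : 0 < (Φ R₁)⁻¹ := inv_pos.2 (hposR R₁ hR₀R₁)
  linarith

end Summit.SmoothPoincare4.SmoothPoincare4.Cruxes.HyperbolicEnd.TaubesCirclePencil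

end
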